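import Literature.AnabelianGeometry.EtaleTheta.SettingModelBTorsionTowerTransport
import HarnessLib

/-!
# LEMMA R1b♯ from (PBF): two stable lines force the cocycle to be a coboundary (ROUTE-PBF file T3)

PROOF-ONLY.  `twistedTorusCoboundary_of_permBasisFixedPoints`.
Classical profinite group theory about OUR semi-synthetic `F₂hatT`; CONDITIONAL (where stated) on the displayed
tree-free hypothesis `PermBasisFixedPoints`; nothing about [EtTh]/[IUTchII]/[IUTchIII] in print; no side on
[IUTchIII] Cor 3.12; nothing here asserts abc proved or refuted.  abc-iut-L6-t19 gen 22 (ROUTE-PBF, rung (L3′) slice 1).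
-/

noncomputable section

namespace Literature.AnabelianGeometry.EtaleTheta.SettingModel.BTorsionTower

open Literature.AnabelianGeometry.EtaleTheta.SettingModel
open Literature.AnabelianGeometry.EtaleTheta (ZHatLevel.level ZHatLevel.levelChar)
open Literature.AnabelianGeometry.SemiGraphs
open Literature.AnabelianGeometry.AbsoluteAnabelian
open Literature.IUT.HodgeTheaters (profiniteCompletion toCompletion)
open CategoryTheory
open Literature.AnabelianGeometry.EtaleTheta.SettingModel.TreeFree (permHat PermBasisFixedPoints permHat_toCompletion)

section Coboundary

variable (p : ℕ) [Fact p.Prime]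

/-- **LEMMA R1b♯ of PL3-R1A, from (PBF) alone.**  `V ≤ G_{ℚ_p}`, `η` a `θ`-cocycle on `V`; if two `b`-lines
`x₁ b^Ẑ x₁⁻¹ ≠ x₂ b^Ẑ x₂⁻¹` are stable under the twisted torus `Inn(η_v) ∘ θ_{χ(v)}` (`v ∈ V`), then `η` is a
coboundary ON THE NOSE: `η_v = y θ_v(y)⁻¹`.  Route: the same tower with the AFFINE permutations
`i ↦ χ_n(v) i + β_n(v)`; a fixed letter exists at every adapted level (else the second line would be the
first), and Cantor intersection in `Ẑ` produces `s` with `β = s − χ s`. [cite: MochizukiEtTh2009, §1 p.12] -/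
theorem twistedTorusCoboundary_of_permBasisFixedPoints (hPBF : PermBasisFixedPoints.{0})
    (V : Subgroup (GQp p)) (η : GQp p → F₂hatT)
    (_hη : ∀ u ∈ V, ∀ v ∈ V, η (u * v) = η u * twist (chi p u) (η v))
    {x₁ x₂ : F₂hatT}
    (h₁ : ∀ v ∈ V, x₁⁻¹ * (η v * twist (chi p v) x₁) ∈ bAxis)
    (h₂ : ∀ v ∈ V, x₂⁻¹ * (η v * twist (chi p v) x₂) ∈ bAxis)
    (hne : x₁⁻¹ * x₂ ∉ bAxis) :
    ∃ y : F₂hatT, ∀ v ∈ V, η v = y * (twist (chi p v) y)⁻¹ := by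
  -- NOTE: the cocycle identity `_hη` is kept for the interface of PL3-R1A's Lemma R1b♯ but is NOT used:
  -- (PBF) is applied to the subgroup generated by the affine permutations, so no group structure on
  -- `{k_v}` is needed.
  classical
  -- (a) the normalised `B`-valued cocycle `β`
  have hβex : ∀ v : V, ∃ t : ZH, bPow t = x₁⁻¹ * (η v * twist (chi p (v : GQp p)) x₁) :=
    fun v => (mem_bAxis_iff _).1 (h₁ v v.2)
  choose βV hβV using hβex
  -- (b) the second line in these coordinates
  set x := x₁⁻¹ * x₂ with hxdef
  clear_value x
  have hx2 : ∀ v : V, x⁻¹ * (bPow (βV v) * twist (chi p (v : GQp p)) x) ∈ bAxis := by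
    intro v
    have h : x⁻¹ * (bPow (βV v) * twist (chi p (v : GQp p)) x) =
        x₂⁻¹ * (η v * twist (chi p (v : GQp p)) x₂) := by
      rw [hβV, hxdef, map_mul, map_inv]; group
    rw [h]; exact h₂ v v.2
  -- (c) a level `M₀` at which `x ∉ b^Ẑ` is visible
  have hxcl : x ∉ closure (eta '' (Subgroup.zpowers (FreeGroup.of 1 : F₂) : Set F₂)) := by
    intro h
    apply hne
    have hcoe : eta '' (Subgroup.zpowers (FreeGroup.of 1 : F₂) : Set F₂) =
        ((Subgroup.zpowers (eta (FreeGroup.of 1))) : Set F₂hatT) := by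
      rw [← MonoidHom.map_zpowers, Subgroup.coe_map]
    rw [hcoe, ← Subgroup.topologicalClosure_coe] at h
    rw [AbsTopII.DehnTwist.bAxis_eq_closure_zpowers]
    exact h
  obtain ⟨M₀, hM₀⟩ : ∃ M₀ : FiniteIndexNormalSubgroup F₂,
      x.val M₀ ∉ (Subgroup.zpowers (FreeGroup.of 1 : F₂)).map (QuotientGroup.mk' M₀.toSubgroup) := by
    by_contra hall
    simp only [not_exists, not_not] at hall
    exact hxcl (Literature.IUT.HodgeTheaters.ProfiniteCompletion.mem_closure_image_of_forall_val_mem hall)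
  haveI : DiscreteTopology ((ProfiniteGrp.ProfiniteCompletion.diagram (GrpCat.of F₂)).obj M₀) := ⟨rfl⟩
  haveI : Finite ((ProfiniteGrp.ProfiniteCompletion.diagram (GrpCat.of F₂)).obj M₀) :=
    inferInstanceAs (Finite (F₂ ⧸ M₀.toSubgroup))
  let ψ₀ := levelMap M₀
  set B₀ := ψ₀ (eta (FreeGroup.of 1)) with hB₀
  let N₀ : ℕ+ := ⟨orderOf B₀, orderOf_pos B₀⟩
  -- (d) the adapted levels
  let Jset : Set ℕ+ := {n | (N₀ : ℕ) ∣ n ∧ Wset p ⊤ n ⊆ ((ZHatLevel.level N₀).ker : Set ZH)}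
  obtain ⟨n₁, hn₁d, hn₁W⟩ := exists_adapted p ⊤ N₀
  have hn₁ : n₁ ∈ Jset := ⟨hn₁d, hn₁W⟩
  have hJmul : ∀ n ∈ Jset, ∀ m : ℕ+, n * m ∈ Jset := fun n hn m =>
    ⟨Dvd.dvd.mul_right hn.1 _, (Wset_anti p ⊤ (dvd_mul_right (n : ℕ) m)).trans hn.2⟩
  -- (e) at every adapted level there is a fixed letter
  have hI : ∀ n : ℕ+, n ∈ Jset → ∃ i₀ : ZMod n, ∀ v : V,
      (chiUnit p n v : ZMod n) * i₀ + Multiplicative.toAdd (ZHatLevel.level n (βV v)) = i₀ := by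
    intro n hn
    have hψ : ψ₀ (eta (FreeGroup.of 1)) ^ (n : ℕ) = 1 := by
      rw [← hB₀]; exact orderOf_dvd_iff_pow_eq_one.1 hn.1
    set q := phi n x with hq
    have hqstab : ∀ v : V, ∃ d : Multiplicative (ZMod n),
        q⁻¹ * affHat n (ZHatLevel.levelChar n (chi p (v : GQp p)))
          (Multiplicative.toAdd (ZHatLevel.level n (βV v))) q = etaL n (SemidirectProduct.inr d) := by
      intro v
      obtain ⟨t, ht⟩ := (mem_bAxis_iff _).1 (hx2 v)
      refine ⟨ZHatLevel.level n t * (ZHatLevel.level n (βV v))⁻¹, ?_⟩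
      have key : phi n (bPow t) = q⁻¹ * (phi n (bPow (βV v)) *
          affHat n (ZHatLevel.levelChar n (chi p (v : GQp p))) 0 q) := by
        rw [ht, map_mul, map_inv, map_mul, phi_twist]
      rw [affHat_eq_conj, ofAdd_toAdd, map_mul SemidirectProduct.inr, map_inv, map_mul (etaL n), map_inv,
        ← phi_bPow, ← phi_bPow, key]
      group
    obtain ⟨ν'', c, hνmem, hqdec, hνfix⟩ := exists_decomp_fixed n
      (fun v : V => ZHatLevel.levelChar n (chi p (v : GQp p)))
      (fun v : V => Multiplicative.toAdd (ZHatLevel.level n (βV v))) q hqstab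
    have hνcl := mem_closure_fixedLetters_of_PBF' n hPBF
      (Set.range fun v : V => (chiUnit p n v, Multiplicative.toAdd (ZHatLevel.level n (βV v))))
      (by rw [← coe_NhatSub]; exact hνmem) (by rintro _ ⟨v, rfl⟩; exact hνfix v)
    by_contra hnone
    simp only [not_exists, not_forall] at hnone
    have hempty : {i : ZMod n | ∀ t ∈ Set.range (fun v : V =>
        (chiUnit p n v, Multiplicative.toAdd (ZHatLevel.level n (βV v)))), (t.1 : ZMod n) * i + t.2 = i} = ∅ := by
      ext i
      simp only [Set.mem_setOf_eq, Set.mem_empty_iff_false, iff_false]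
      intro hi
      obtain ⟨v, hv⟩ := hnone i
      exact hv (hi _ ⟨v, rfl⟩)
    rw [hempty, Set.image_empty, Subgroup.closure_empty, Subgroup.coe_bot, Set.image_singleton,
      Set.image_singleton, map_one, map_one, closure_singleton, Set.mem_singleton_iff] at hνcl
    apply hM₀
    rw [MonoidHom.map_zpowers]
    change ψ₀ x ∈ Subgroup.zpowers (ψ₀ (eta (FreeGroup.of 1)))
    rw [← rho_phi n ψ₀ hψ x, ← hq, hqdec, hνcl, one_mul, rho_etaL, lamPart_inr, ← hB₀]
    haveI : NeZero (n : ℕ) := ⟨n.ne_zero⟩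
    have h := rotPart_ofAdd_intCast n ψ₀ hψ ((Multiplicative.toAdd c).val : ℤ)
    rw [Int.cast_natCast, ZMod.natCast_zmod_val, ofAdd_toAdd, ← hB₀] at h
    rw [h]
    exact Subgroup.zpow_mem_zpowers B₀ _
  -- (f) Cantor intersection in `Ẑ` over the adapted levels
  haveI : Nonempty {n : ℕ+ // n ∈ Jset} := ⟨⟨n₁, hn₁⟩⟩
  let D : {n : ℕ+ // n ∈ Jset} → Set ZH := fun n =>
    {s | ∀ v : V, ZHatLevel.level n.1 (βV v) = ZHatLevel.level n.1 (s * ((chi p (v : GQp p)) s)⁻¹)}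
  have hDclosed : ∀ n, IsClosed (D n) := by
    intro n
    have h : D n = ⋂ v : V, {s | ZHatLevel.level n.1 (βV v) = ZHatLevel.level n.1 (s * ((chi p (v : GQp p)) s)⁻¹)} := by
      ext s; simp [D]
    rw [h]
    refine isClosed_iInter fun v => isClosed_eq continuous_const ?_
    exact (continuous_level n.1).comp
      (continuous_id.mul ((ZHatLevel.continuous_mulEquiv (chi p (v : GQp p))).1.comp continuous_id).inv)
  have hDne : ∀ n, (D n).Nonempty := by
    intro n
    obtain ⟨i₀, hi₀⟩ := hI n.1 n.2
    haveI : NeZero (n.1 : ℕ) := ⟨n.1.ne_zero⟩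
    refine ⟨ZHatLevel.eta (i₀.val : ℤ), fun v => ?_⟩
    have hls : ZHatLevel.level n.1 (ZHatLevel.eta (i₀.val : ℤ)) = Multiplicative.ofAdd i₀ := by
      rw [ZHatLevel.level_eta, Int.cast_natCast, ZMod.natCast_zmod_val]
    have hlχ := ZHatLevel.toAdd_level_aut n.1 (chi p (v : GQp p)) (ZHatLevel.eta (i₀.val : ℤ))
    rw [hls, toAdd_ofAdd] at hlχ
    rw [map_mul, map_inv, hls, ← ofAdd_toAdd (ZHatLevel.level n.1 ((chi p (v : GQp p)) _)), hlχ,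
      ← ofAdd_toAdd (ZHatLevel.level n.1 (βV v)), ← ofAdd_neg, ← ofAdd_add]
    congr 1
    have h := hi₀ v
    rw [coe_chiUnit] at h
    linear_combination h
  have hDdir : Directed (· ⊇ ·) D := by
    intro a b
    refine ⟨⟨a.1 * b.1, hJmul a.1 a.2 b.1⟩, fun s hs v => ?_, fun s hs v => ?_⟩
    · exact level_eq_of_dvd (dvd_mul_right (a.1 : ℕ) b.1) (hs v)
    · exact level_eq_of_dvd (dvd_mul_left (b.1 : ℕ) a.1) (hs v)
  obtain ⟨s, hs⟩ := IsCompact.nonempty_iInter_of_directed_nonempty_isCompact_isClosed D hDdir hDne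
    (fun n => (hDclosed n).isCompact) hDclosed
  -- (g) `β = s · (χ s)⁻¹` in `Ẑ`
  have hβs : ∀ v : V, βV v = s * ((chi p (v : GQp p)) s)⁻¹ := by
    intro v
    apply ZHatLevel.ext_of_level
    intro m
    have hnm : n₁ * m ∈ Jset := hJmul n₁ hn₁ m
    have h := (Set.mem_iInter.1 hs) ⟨n₁ * m, hnm⟩ v
    exact level_eq_of_dvd (dvd_mul_left (m : ℕ) n₁) h
  -- (h) the coboundary
  refine ⟨x₁ * bPow s, fun v hv => ?_⟩
  have h := hβV ⟨v, hv⟩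
  rw [hβs ⟨v, hv⟩, map_mul, map_inv, ← twist_bPow] at h
  change bPow s * (twist (chi p v) (bPow s))⁻¹ = x₁⁻¹ * (η v * twist (chi p v) x₁) at h
  rw [map_mul]
  calc η v = x₁ * (x₁⁻¹ * (η v * twist (chi p v) x₁)) * (twist (chi p v) x₁)⁻¹ := by group
    _ = x₁ * (bPow s * (twist (chi p v) (bPow s))⁻¹) * (twist (chi p v) x₁)⁻¹ := by rw [h]
    _ = x₁ * bPow s * (twist (chi p v) x₁ * twist (chi p v) (bPow s))⁻¹ := by group
end Coboundary

end Literature.AnabelianGeometry.EtaleTheta.SettingModel.BTorsionTower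

end
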